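import Summits.BirchSwinnertonDyer.Rank1Residual.X11b.BDPRouteOpenInputPrint
import HarnessLib

/-!
# Class X11b, route p2 at `p ≥ 5`: RECORDS IN PRINT CURRENCY — the semistable end state (PUB +
# cited + ONE OPEN divisibility + at most ONE certificate per pair) and the class-level record
# (cell `b2b-bsdres`, sub-cell `multr1-p2`, gen 23)

HONEST FRAMING (cell `b2b-bsdres`, run/shared/lean/b2b/bsd-rank1-residual/, verbatim in every
file): the goal of the cell is to DELETE the COMBINATION-SHAPED residual classes of the
Birch–Swinnerton-Dyer formula for ALL analytic-rank `≤ 1` elliptic curves over `ℚ` — "full BSD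
formula for every rank `≤ 1` curve in class `C`" assembled STRICTLY from published theorems — so
that the rank-`≤ 1` remainder becomes exactly the CONSTRUCTION-SHAPED classes, which are TYPED
(missing-input `Prop`s), NOT attempted. This is not "finishing BSD". Sub-cell `multr1-p2` is a
RESEARCH ROUTE on class X11b (`ClassX11b W p := r_an = 1 ∧ p ≠ 2 ∧ mult(p) ∧ irr(p)`,
`Partition/Rows.lean`); no claim beyond the stated class and loci; X11b's label does not change;
NOTHING is booked by this file.

THEOREMS ONLY (no definition, no named fact, no `sorry`). Companion of
`X11b/BDPRouteOpenInputPrint.lean` (gen 23): there route p2's open input `P2OpenInputOnTreeAt W p` is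
derived on EVERY SEMISTABLE pair from the PUBLISHED Castella 2018 Thms. 3.1–3.2 (`h32`), Kolyvagin,
the cited Poitou–Tate / local Euler characteristic, and the ONE OPEN input `P2.IMCDivOnTree W p` =
the divisibility (2.4) `Ch_Λ(X_ac)·R₀⟦T⟧ ⊆ (L_p(f))` for Castella's published `L_p(f)` [⇐ FW21
Thm. 4.41, PREPRINT] (`P2.openInputOnTreeAt_of_imcDiv_of_facts`), and the semistable shape is settled
in the kernel (no corner by Serre Prop. 21 i); no split-only residue: prime conductor and odd rank
force non-split reduction). Here the consequences are recorded, the open input AT THE PAIR: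

* §3 `P2.missingLowerBoundAt_of_imcDiv` (main-conjecture half on a semistable pair),
  `P2.bsdp_of_locus_of_imcDiv` (semistable Locus, 723 144 ‖ 28 657 pairs: PUB + cited + (2.4), NOTHING
  per pair — multr1-p1's `P2.bsdp_of_imcDiv_of_locus` without the three cited duality facts of the
  control identity), **`P2.bsdp_of_semistable_of_imcDiv_of_regulatorNonvanishing`** (EVERY semistable
  pair, 753 185 ‖ 30 086: PUB + cited + (2.4) + ONE `p`-adic height; no (∗), no corner, no conjecture,
  no Shimura display), `P2.bsdp_and_bsdp_twist_of_imcDiv_of_twistUnit` (`p ∤ ∏c`: (2.4) + ONE twist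
  certificate, also `BSD(E^{d_K},p)`), and the END STATE **`P2.bsdp_of_semistable_of_imcDiv`**: (2.4)
  at the pair + [NOTHING on the Locus | ONE certificate (REG, or TC when `p ∤ ∏c`) on the other
  30 041 ‖ 1 429 semistable pairs].
* §4 CLASS-LEVEL RECORD **`P2.bsdp_of_onTree_print`**: gen 22's
  `P2.bsdp_of_onTree_cyclotomic_twistCertificate` with (T1) := (2.4) on the semistable pairs and (T1)
  kept in the route's own currency (`P2OpenInputOnTreeAt`) on the non-semistable ones (Cas18 Thms.
  3.1–3.2 are printed for square-free `N` only; 1 514 163 ‖ 40 334 pairs).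

Census: multr1-p1 `census500k` (N < 5·10⁵ ‖ N < 2·10⁴), recount `census23/` in the seat dir.
CONDITIONAL on (2.4); deletes nothing; labels UNCHANGED; X11b stays CONSTRUCTION-SHAPED; REG / TC
are per-pair certificates whose class-wide existence is not in print.

References: [Castella2018] Thms. 2.3, 3.1, 3.2, §5 (arXiv:1704.06608 pp. 5, 9, 12);
[Castella2018Erratum] (2.4), Thm. 1.1; [FouquetWan2021] Thm. 4.41; [Serre1972] §5.4 Prop. 21;
[Disegni2020] Thm. 1, (∗); [McCallumLMS1991] §1; [Skinner2016PacificMC] Thm. C; [Miller2011LMS] Def. 1.1.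
-/

noncomputable section

open scoped Classical NumberField

open WeierstrassCurve NumberField IsDedekindDomain Field PowerSeries
open Literature.NumberTheory.EllipticCurves Literature.NumberTheory.EllipticCurves.GreenbergSelmer
open Literature.NumberTheory.EllipticCurves.ModularForms
open Literature.NumberTheory.EllipticCurves.Rank1Residual
open Literature.NumberTheory.EllipticCurves.Rank1Residual.Typed
open Literature.NumberTheory.EllipticCurves.Wuthrich2014
open Literature.NumberTheory.EllipticCurves.Castella2018
open Literature.NumberTheory.EllipticCurves.SteinWuthrich2013
open Literature.NumberTheory.EllipticCurves.Disegni2020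
open Literature.NumberTheory.EllipticCurves.Skinner2016
open Literature.NumberTheory.EllipticCurves.BalakrishnanEtAl2019
open Literature.NumberTheory.QuadraticFields.Quadratic
open Literature.NumberTheory.GaloisRepresentations Literature.NumberTheory.GaloisCohomology
open Summit.BirchSwinnertonDyer.Rank1Residual.X11b.AcSelmer
open Summit.BirchSwinnertonDyer.Rank1Residual.X11b.Halves

namespace Summit.BirchSwinnertonDyer.Rank1Residual.X11b

/-! ### §3 Records on SEMISTABLE pairs: the open input AT THE PAIR, in print currency -/

section Semistable

variable (W : WeierstrassCurve ℚ) [W.IsElliptic] [W.IsGloballyMinimal] (p : ℕ) [Fact p.Prime]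

/-- **The main-conjecture half `ord_p #Ш(E)_an ≤ ord_p #Ш(E)` on a SEMISTABLE X11b pair at `p ≥ 5`
from published + cited facts and (2.4) at the pair.** `P2.missingLowerBoundAt_of_openInputAt` (gen 18)
with the open input supplied by `P2.openInputOnTreeAt_of_imcDiv_of_facts` and `Surj` by Serre's
Prop. 21 i). CONDITIONAL on (2.4); nothing booked. [cite: Castella2018Erratum, (2.4) (p. 4)]
[cite: Castella2018, Thms. 2.3, 3.2] [cite: JetchevSkinnerWan2017, §7.4.1 (pp. 30–31)]
[cite: Wuthrich2014, Prop. 21 (p. 400)] [cite: Miller2011LMS, Def. 1.1] -/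
theorem P2.missingLowerBoundAt_of_imcDiv
    (hGZ : ∀ (N : ℕ) [NeZero N] (W : WeierstrassCurve ℚ) (K : Type) [Field K] [NumberField K],
      gross_zagier N W K)
    (hKo : ∀ (N : ℕ) [NeZero N] (W : WeierstrassCurve ℚ) (K : Type) [Field K] [NumberField K],
      kolyvagin N W K)
    (hWu : sha_dvd_analyticSha) (hGZK : rank_eq_analyticRank_of_analyticRank_le_one)
    (hnf : exists_isNewformOf) (hHL : HoffsteinLuo1997_exists_twist_L_one_ne_zero)
    (hMaz : mazur_not_dvd_maninConstant_of_odd) (h32 : thm32_exists_isBDPLFunction_valueAtOne)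
    (hPT : ∀ (K : Type) [Field K] [NumberField K], poitouTate_sum_localTatePairing_eq_zero K)
    (hEP : ∀ (K : Type) [Field K] [NumberField K] (v : HeightOneSpectrum (𝓞 K)),
      localEulerPoincareCharacteristic (v.adicCompletion K))
    -- the pair: semistable, X11b, `p ≥ 5`; (2.4) at the pair
    (hss : Semistable W) (h3 : P2.IMCDivOnTree W p) (hX : ClassX11b W p) (hp5 : 5 ≤ p) :
    Typed.MissingLowerBoundAt W p :=
  P2.missingLowerBoundAt_of_openInputAt W p hGZ hKo hWu hGZK
    (hasEntireLFunction_rat_of_exists_isNewformOf hnf) hnf hHL hMaz hPT hEP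
    (P2.openInputOnTreeAt_of_imcDiv_of_facts h32 hnf hGZK hKo hPT hEP hss h3) hX hp5
    (surj_of_irr_of_semistable W p hX.2.2.2 hss)

/-- **A1 ∧ semistable (723 144 ‖ 28 657 pairs): `BSD(E,p)` from published + cited facts and (2.4)
at the pair — NOTHING per pair.** multr1-p1's `P2.bsdp_of_imcDiv_of_locus` needed the control
IDENTITY (three more cited duality facts, via x11b3-p9); here gen 18's `P2.bsdp_of_locus_endState`
with the open input from §1 (one-sided control suffices). PUBLISHED binders: Gross–Zagier, Kolyvagin
×2, Skinner 2016 Thm. C, Wuthrich Prop. 21, GZK, modularity, Hoffstein–Luo, Mazur 1978 Cor. 4.1,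
Castella 2018 Thms. 3.1–3.2; CITED: Poitou–Tate, local Euler characteristic; OPEN: (2.4).
CONDITIONAL; nothing booked. [cite: Castella2018, §5 (arXiv:1704.06608 p. 12)]
[cite: Castella2018Erratum, (2.4), Thm. 1.1 (pp. 1, 4)] [cite: Skinner2016PacificMC, Thm. C (§1)]
[cite: McCallumLMS1991, §1 Theorem (Kolyvagin), p. 296] [cite: Miller2011LMS, Def. 1.1] -/
theorem P2.bsdp_of_locus_of_imcDiv
    (hGZ : ∀ (N : ℕ) [NeZero N] (W : WeierstrassCurve ℚ) (K : Type) [Field K] [NumberField K],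
      gross_zagier N W K)
    (hKo : ∀ (N : ℕ) [NeZero N] (W : WeierstrassCurve ℚ) (K : Type) [Field K] [NumberField K],
      kolyvagin N W K)
    (hB : ∀ (N : ℕ) [NeZero N] (W : WeierstrassCurve ℚ) (K : Type) [Field K] [NumberField K],
      Kolyvagin1990_padicValNat_card_sha_le N W K)
    (hSk : Skinner2016.thmC_padicValRat_bsd_rank_zero) (hWu : sha_dvd_analyticSha)
    (hGZK : rank_eq_analyticRank_of_analyticRank_le_one) (hnf : exists_isNewformOf)
    (hHL : HoffsteinLuo1997_exists_twist_L_one_ne_zero) (hMaz : mazur_not_dvd_maninConstant_of_odd)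
    (h32 : thm32_exists_isBDPLFunction_valueAtOne)
    (hPT : ∀ (K : Type) [Field K] [NumberField K], poitouTate_sum_localTatePairing_eq_zero K)
    (hEP : ∀ (K : Type) [Field K] [NumberField K] (v : HeightOneSpectrum (𝓞 K)),
      localEulerPoincareCharacteristic (v.adicCompletion K))
    (hss : Semistable W) (h3 : P2.IMCDivOnTree W p)
    (hX : ClassX11b W p) (hp5 : 5 ≤ p) (hram : Ram W p) (htam : ¬ p ∣ W.tamagawaProduct) :
    BSDp W p :=
  P2.bsdp_of_locus_endState W p hGZ hKo hB hSk hWu hGZK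
    (hasEntireLFunction_rat_of_exists_isNewformOf hnf) hnf hHL hMaz hPT hEP
    (P2.openInputOnTreeAt_of_imcDiv_of_facts h32 hnf hGZK hKo hPT hEP hss h3) hX hp5 hram htam

/-- **EVERY SEMISTABLE X11b PAIR AT `p ≥ 5` (753 185 ‖ 30 086 pairs): `BSD(E,p)` from published +
cited facts, (2.4) at the pair, and ONE `p`-adic height at the pair.** Lower half: §1 + gen 18.
Upper half: the one-sided cyclotomic lever (gen 21, `missingUpperBoundAt_of_katoSurj_of_regulatorNonvanishing`:
Kato's divisibility under onto image, Stein–Wuthrich Thm. 6.1, Disegni Thm. 1, the regulator input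
`ClassClosure.RegulatorNonvanishingAt W p`), whose two side conditions are THEOREMS on semistable
pairs: `Surj` (Serre Prop. 21 i)) and Disegni's (∗) (`disegniStar_of_classX11b_of_semistable`: a
semistable split-only pair would have prime conductor and odd rank, hence be non-split). NO corner,
NO (T2∗) conjecture, NO Shimura display, NO (ram) hypothesis. PUBLISHED binders: route p2's
(Gross–Zagier, Kolyvagin, Wuthrich Prop. 21, GZK, modularity, Hoffstein–Luo, Mazur) + Castella 2018
Thms. 3.1–3.2 + the lever's (Kato/Wuthrich Thm. 3, Stein–Wuthrich Thm. 6.1 ×2 and §4.2 ×2, Disegni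
Thm. 1, a modular parametrisation); CITED: Poitou–Tate, local Euler characteristic; OPEN: (2.4); PER
PAIR: REG. CONDITIONAL; nothing booked; X11b stays CONSTRUCTION-SHAPED.
[cite: Castella2018Erratum, (2.4) (p. 4)] [cite: Castella2018, Thms. 2.3, 3.1, 3.2]
[cite: Wuthrich2014, Thm. 3 (p. 383), Prop. 21 (p. 400)] [cite: SteinWuthrich2013, Thm. 6.1, §4.2]
[cite: Disegni2020, Thm. 1 (§1.2), (∗)] [cite: Serre1972, §5.4 Prop. 21 i)] [cite: Miller2011LMS, Def. 1.1] -/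
theorem P2.bsdp_of_semistable_of_imcDiv_of_regulatorNonvanishing
    -- route p2's published inputs
    (hGZ : ∀ (N : ℕ) [NeZero N] (W : WeierstrassCurve ℚ) (K : Type) [Field K] [NumberField K],
      gross_zagier N W K)
    (hKo : ∀ (N : ℕ) [NeZero N] (W : WeierstrassCurve ℚ) (K : Type) [Field K] [NumberField K],
      kolyvagin N W K)
    (hWu : sha_dvd_analyticSha) (hGZK : rank_eq_analyticRank_of_analyticRank_le_one)
    (hnf : exists_isNewformOf) (hHL : HoffsteinLuo1997_exists_twist_L_one_ne_zero)
    (hMaz : mazur_not_dvd_maninConstant_of_odd) (h32 : thm32_exists_isBDPLFunction_valueAtOne)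
    (hPT : ∀ (K : Type) [Field K] [NumberField K], poitouTate_sum_localTatePairing_eq_zero K)
    (hEP : ∀ (K : Type) [Field K] [NumberField K] (v : HeightOneSpectrum (𝓞 K)),
      localEulerPoincareCharacteristic (v.adicCompletion K))
    -- the lever's published inputs
    (hK : kato_charIdeal_dvd_multiplicative_of_surjective)
    (hJn : thm61_nonsplitMultiplicative) (hJs : thm61_splitMultiplicative)
    (hHn : exists_isMultCanonical) (hHs : exists_isSplitMultCanonical)
    (hD : thm1_padicBSD_rankOne_multiplicative) (hpar : nonempty_modularParametrizationData)
    -- the pair: semistable; (2.4) at the pair; ONE `p`-adic height at the pair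
    (hss : Semistable W) (h3 : P2.IMCDivOnTree W p) (hReg : ClassClosure.RegulatorNonvanishingAt W p)
    (hX : ClassX11b W p) (hp5 : 5 ≤ p) : BSDp W p :=
  P2.bsdp_of_surj_of_regulatorNonvanishing W p hGZ hKo hWu hGZK
    (hasEntireLFunction_rat_of_exists_isNewformOf hnf) hnf hHL hMaz hPT hEP hK hJn hJs hHn hHs hD hpar
    (P2.openInputOnTreeAt_of_imcDiv_of_facts h32 hnf hGZK hKo hPT hEP hss h3) hReg hX hp5
    (surj_of_irr_of_semistable W p hX.2.2.2 hss) (disegniStar_of_classX11b_of_semistable hnf hX hss)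

/-- **Semistable X11b pair at `p ≥ 5` with `p ∤ ∏_ℓ c_ℓ(E)`: (2.4) at the pair + ONE twist
certificate ⟹ `BSD(E,p)` AND `BSD(E^{d_K},p)`** (gen 22's `P2.bsdp_and_bsdp_twist_of_openInputAt_of_twistUnit`
with the open input from §1 and `Surj` from Serre): a Heegner field `K` (`d_K < −4`), a globally
minimal model `Wd` of `E^{d_K}` and its algebraic central value `q_d = L(E^{d_K},1)/Ω(Wd) ≠ 0` with
`ord_p q_d = 0`. NO `p`-adic height. Reach: the semistable Locus (723 144) and the semistable ¬(ram)
pairs (2 517 ‖ 230, all non-split at `p` with `p ∤ ∏c`; gen 22's census: a certificate exists at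
every one of them). CONDITIONAL on (2.4); per pair; nothing booked.
[cite: McCallumLMS1991, §1 Theorem (Kolyvagin), p. 296] [cite: Castella2018Erratum, (2.4) (p. 4)]
[cite: JetchevSkinnerWan2017, §7.4.1 (pp. 30–31)] [cite: Miller2011LMS, Def. 1.1] -/
theorem P2.bsdp_and_bsdp_twist_of_imcDiv_of_twistUnit
    (hGZ : ∀ (N : ℕ) [NeZero N] (W : WeierstrassCurve ℚ) (K : Type) [Field K] [NumberField K],
      gross_zagier N W K)
    (hKo : ∀ (N : ℕ) [NeZero N] (W : WeierstrassCurve ℚ) (K : Type) [Field K] [NumberField K],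
      kolyvagin N W K)
    (hB : ∀ (N : ℕ) [NeZero N] (W : WeierstrassCurve ℚ) (K : Type) [Field K] [NumberField K],
      Kolyvagin1990_padicValNat_card_sha_le N W K)
    (hWu : sha_dvd_analyticSha) (hGZK : rank_eq_analyticRank_of_analyticRank_le_one)
    (hnf : exists_isNewformOf) (hHL : HoffsteinLuo1997_exists_twist_L_one_ne_zero)
    (hMaz : mazur_not_dvd_maninConstant_of_odd) (h32 : thm32_exists_isBDPLFunction_valueAtOne)
    (hPT : ∀ (K : Type) [Field K] [NumberField K], poitouTate_sum_localTatePairing_eq_zero K)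
    (hEP : ∀ (K : Type) [Field K] [NumberField K] (v : HeightOneSpectrum (𝓞 K)),
      localEulerPoincareCharacteristic (v.adicCompletion K))
    -- the pair: semistable; (2.4) at the pair; `p ∤ ∏c`
    (hss : Semistable W) (h3 : P2.IMCDivOnTree W p)
    (hX : ClassX11b W p) (hp5 : 5 ≤ p) (htam : ¬ p ∣ W.tamagawaProduct)
    -- the certificate
    (K : Type) [Field K] [NumberField K] (hK : IsImaginaryQuadratic K)
    (hHN : SatisfiesHeegnerHypothesis (W.conductorNorm ℤ) K) (hdK : NumberField.discr K < -4)
    (Wd : WeierstrassCurve ℚ) [Wd.IsElliptic] [Wd.IsGloballyMinimal] (Cd : VariableChange ℚ)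
    (hWd : Cd • W.quadraticTwist (NumberField.discr K : ℚ) = Wd)
    (qd : ℚ) (hqd : Wd.entireLFunction 1 / (Wd.realPeriodRat : ℂ) = (qd : ℂ)) (hqd0 : qd ≠ 0)
    (hvd : padicValRat p qd = 0) :
    BSDp W p ∧ BSDp Wd p :=
  P2.bsdp_and_bsdp_twist_of_openInputAt_of_twistUnit W p hGZ hKo hB hWu hGZK
    (hasEntireLFunction_rat_of_exists_isNewformOf hnf) hnf hHL hMaz hPT hEP
    (P2.openInputOnTreeAt_of_imcDiv_of_facts h32 hnf hGZK hKo hPT hEP hss h3) hX hp5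
    (surj_of_irr_of_semistable W p hX.2.2.2 hss) htam K hK hHN hdK Wd Cd hWd qd hqd hqd0 hvd

/-- **THE SEMISTABLE END STATE OF ROUTE p2 (gen 23).** For every globally minimal SEMISTABLE
elliptic `W/ℚ` and prime `p` with `(E,p)` in X11b and `p ≥ 5`: `BSD(E,p)` from published named facts
(route p2's + Castella 2018 Thms. 3.1–3.2 + Kolyvagin 1990 Thm. A + Skinner 2016 Thm. C + the lever's),
the two cited textbook facts (Poitou–Tate, local Euler characteristic), the ONE OPEN input (2.4) for
Castella's `L_p(f)` AT THE PAIR (`P2.IMCDivOnTree W p`, literally "[FW21, Thm. 4.41] ⟹ (2.4)" of the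
erratum, PREPRINT), and — ONLY OFF THE LOCUS (`p ∣ ∏c` or no (ram) prime: 30 041 ‖ 1 429 of the
753 185 ‖ 30 086 semistable pairs) — ONE per-pair certificate: the `p`-adic height (REG), or, when
`p ∤ ∏c`, a twist certificate (TC). On the semistable Locus (723 144 ‖ 28 657) NOTHING per pair.
NO corner, NO (T2∗) conjecture, NO Shimura display (§2). CONDITIONAL; nothing booked; labels
UNCHANGED; X11b stays CONSTRUCTION-SHAPED ((2.4) unrefereed; REG = Schneider's conjecture class-wide;
TC's class-wide existence not in print). [cite: Castella2018Erratum, (2.4) (p. 4)]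
[cite: Castella2018, Thms. 2.3, 3.1, 3.2, §5] [cite: Skinner2016PacificMC, Thm. C (§1)]
[cite: McCallumLMS1991, §1 Theorem (Kolyvagin), p. 296] [cite: Disegni2020, Thm. 1 (§1.2), (∗)]
[cite: Wuthrich2014, Thm. 3 (p. 383), Prop. 21 (p. 400)] [cite: SteinWuthrich2013, Thm. 6.1, §4.2]
[cite: Serre1972, §5.4 Prop. 21 i)] [cite: Miller2011LMS, Def. 1.1] -/
theorem P2.bsdp_of_semistable_of_imcDiv
    -- route p2's published inputs
    (hGZ : ∀ (N : ℕ) [NeZero N] (W : WeierstrassCurve ℚ) (K : Type) [Field K] [NumberField K],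
      gross_zagier N W K)
    (hKo : ∀ (N : ℕ) [NeZero N] (W : WeierstrassCurve ℚ) (K : Type) [Field K] [NumberField K],
      kolyvagin N W K)
    (hB : ∀ (N : ℕ) [NeZero N] (W : WeierstrassCurve ℚ) (K : Type) [Field K] [NumberField K],
      Kolyvagin1990_padicValNat_card_sha_le N W K)
    (hSk : Skinner2016.thmC_padicValRat_bsd_rank_zero) (hWu : sha_dvd_analyticSha)
    (hGZK : rank_eq_analyticRank_of_analyticRank_le_one) (hnf : exists_isNewformOf)
    (hHL : HoffsteinLuo1997_exists_twist_L_one_ne_zero) (hMaz : mazur_not_dvd_maninConstant_of_odd)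
    (h32 : thm32_exists_isBDPLFunction_valueAtOne)
    (hPT : ∀ (K : Type) [Field K] [NumberField K], poitouTate_sum_localTatePairing_eq_zero K)
    (hEP : ∀ (K : Type) [Field K] [NumberField K] (v : HeightOneSpectrum (𝓞 K)),
      localEulerPoincareCharacteristic (v.adicCompletion K))
    -- the lever's published inputs
    (hK : kato_charIdeal_dvd_multiplicative_of_surjective)
    (hJn : thm61_nonsplitMultiplicative) (hJs : thm61_splitMultiplicative)
    (hHn : exists_isMultCanonical) (hHs : exists_isSplitMultCanonical)
    (hD : thm1_padicBSD_rankOne_multiplicative) (hpar : nonempty_modularParametrizationData)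
    -- the pair: semistable X11b, `p ≥ 5`; THE OPEN INPUT (2.4) at the pair
    (hss : Semistable W) (h3 : P2.IMCDivOnTree W p) (hX : ClassX11b W p) (hp5 : 5 ≤ p)
    -- OFF the Locus: ONE certificate — the `p`-adic height, or (`p ∤ ∏c`) a twist certificate
    (hcert : ¬ (Ram W p ∧ ¬ p ∣ W.tamagawaProduct) →
      ClassClosure.RegulatorNonvanishingAt W p ∨
      (¬ p ∣ W.tamagawaProduct ∧
        ∃ (K : Type) (_ : Field K) (_ : NumberField K) (Wd : WeierstrassCurve ℚ) (_ : Wd.IsElliptic)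
          (_ : Wd.IsGloballyMinimal) (Cd : VariableChange ℚ) (qd : ℚ),
          IsImaginaryQuadratic K ∧ SatisfiesHeegnerHypothesis (W.conductorNorm ℤ) K ∧
          NumberField.discr K < -4 ∧ Cd • W.quadraticTwist (NumberField.discr K : ℚ) = Wd ∧
          Wd.entireLFunction 1 / (Wd.realPeriodRat : ℂ) = (qd : ℂ) ∧ qd ≠ 0 ∧ padicValRat p qd = 0)) :
    BSDp W p := by
  by_cases hloc : Ram W p ∧ ¬ p ∣ W.tamagawaProduct
  · exact P2.bsdp_of_locus_of_imcDiv W p hGZ hKo hB hSk hWu hGZK hnf hHL hMaz h32 hPT hEP hss h3 hX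
      hp5 hloc.1 hloc.2
  · rcases hcert hloc with hReg | ⟨htam, K, _, _, Wd, _, _, Cd, qd, hK', hHN, hdK, hWd, hqd, hqd0, hvd⟩
    · exact P2.bsdp_of_semistable_of_imcDiv_of_regulatorNonvanishing W p hGZ hKo hWu hGZK hnf hHL
        hMaz h32 hPT hEP hK hJn hJs hHn hHs hD hpar hss h3 hReg hX hp5
    · exact (P2.bsdp_and_bsdp_twist_of_imcDiv_of_twistUnit W p hGZ hKo hB hWu hGZK hnf hHL hMaz h32
        hPT hEP hss h3 hX hp5 htam K hK' hHN hdK Wd Cd hWd qd hqd hqd0 hvd).1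

end Semistable

/-! ### §4 The class-level record in print currency -/

/-- **Route p2 — STATEMENT OF RECORD IN PRINT CURRENCY (gen 23).** `∀ (E, p) ∈` X11b,
`p ≥ 5 → BSD(E, p)` from route p2's and the lever's published named facts (+ Kolyvagin 1990 Thm. A,
Castella 2018 Thms. 3.1–3.2), the cited Poitou–Tate / local Euler characteristic, and the typed
inputs: **(T1-print) on the SEMISTABLE pairs (753 185 ‖ 30 086 of 2 267 348 ‖ 70 420): the
divisibility (2.4) `Ch_Λ(X_ac)·R₀⟦T⟧ ⊆ (L_p(f))` for Castella's published `L_p(f)`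
(`P2.IMCDivOnTree`) [⇐ FW21 Thm. 4.41, PREPRINT]**; (T1) on the NON-semistable pairs: the open input
in the route's own currency `P2OpenInputOnTreeAt` (Cas18 Thms. 3.1–3.2 are printed for square-free
`N` only); (REG) per pair; (TC) one twist certificate per split-only pair with `p ∤ ∏c` (54 755 ‖
3 291, none semistable); (T2∗′) the conjecture `RelativeExceptionalLeadingTermAt` only on split-only
pairs with `p ∣ ∏c` (334 ‖ 35, none semistable); (T4′) the corner (64 ‖ 5, none semistable). Gen
22's `P2.bsdp_of_onTree_cyclotomic_twistCertificate` with (T1) split by semistability through §1.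
CONDITIONAL; nothing booked; labels UNCHANGED; X11b stays CONSTRUCTION-SHAPED.
[cite: Castella2018Erratum, (2.4) (p. 4)] [cite: Castella2018, Thms. 2.3, 3.1, 3.2]
[cite: McCallumLMS1991, §1 Theorem (Kolyvagin), p. 296] [cite: Disegni2020, Thm. 1 (§1.2), Thm. 4, (∗)]
[cite: Wuthrich2014, Thm. 3 (p. 383), Prop. 21 (p. 400)] [cite: SteinWuthrich2013, Thm. 6.1, §4.2]
[cite: Miller2011LMS, Def. 1.1] -/
theorem P2.bsdp_of_onTree_print
    -- route p2's published inputs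
    (hGZ : ∀ (N : ℕ) [NeZero N] (W : WeierstrassCurve ℚ) (K : Type) [Field K] [NumberField K],
      gross_zagier N W K)
    (hKo : ∀ (N : ℕ) [NeZero N] (W : WeierstrassCurve ℚ) (K : Type) [Field K] [NumberField K],
      kolyvagin N W K)
    (hB : ∀ (N : ℕ) [NeZero N] (W : WeierstrassCurve ℚ) (K : Type) [Field K] [NumberField K],
      Kolyvagin1990_padicValNat_card_sha_le N W K)
    (hWu : sha_dvd_analyticSha) (hGZK : rank_eq_analyticRank_of_analyticRank_le_one)
    (hnf : exists_isNewformOf) (hHL : HoffsteinLuo1997_exists_twist_L_one_ne_zero)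
    (hMaz : mazur_not_dvd_maninConstant_of_odd) (hBDMTV : thm12_not_le_normalizer_splitCartan)
    (h32 : thm32_exists_isBDPLFunction_valueAtOne)
    (hPT : ∀ (K : Type) [Field K] [NumberField K], poitouTate_sum_localTatePairing_eq_zero K)
    (hEP : ∀ (K : Type) [Field K] [NumberField K] (v : HeightOneSpectrum (𝓞 K)),
      localEulerPoincareCharacteristic (v.adicCompletion K))
    -- the lever's published inputs
    (hK : kato_charIdeal_dvd_multiplicative_of_surjective)
    (hJn : thm61_nonsplitMultiplicative) (hJs : thm61_splitMultiplicative)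
    (hHn : exists_isMultCanonical) (hHs : exists_isSplitMultCanonical)
    (hD : thm1_padicBSD_rankOne_multiplicative) (hpar : nonempty_modularParametrizationData)
    -- (T1-print) the divisibility (2.4) for Castella's `L_p(f)`, on the SEMISTABLE pairs
    (hDiv : ∀ (W : WeierstrassCurve ℚ) [W.IsElliptic] [W.IsGloballyMinimal] (p : ℕ) [Fact p.Prime],
      ClassX11b W p → 5 ≤ p → Semistable W → P2.IMCDivOnTree W p)
    -- (T1) THE open input in the route's own currency, on the NON-semistable pairs only
    (hA : ∀ (W : WeierstrassCurve ℚ) [W.IsElliptic] [W.IsGloballyMinimal] (p : ℕ) [Fact p.Prime],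
      ClassX11b W p → 5 ≤ p → ¬ Semistable W → P2OpenInputOnTreeAt W p)
    -- (REG)
    (hReg : ∀ (W : WeierstrassCurve ℚ) [W.IsElliptic] [W.IsGloballyMinimal] (p : ℕ) [Fact p.Prime],
      ClassX11b W p → 5 ≤ p → ClassClosure.RegulatorNonvanishingAt W p)
    -- (TC) ONE twist certificate per split-only pair with `p ∤ ∏c` (none is semistable)
    (hTC : ∀ (W : WeierstrassCurve ℚ) [W.IsElliptic] [W.IsGloballyMinimal] (p : ℕ) [Fact p.Prime],
      ClassX11b W p → 5 ≤ p → W.HasSplitMultiplicativeReductionAtPrime p →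
      (¬ ∃ (m : ℕ) (_ : Fact m.Prime), m ≠ p ∧ W.HasMultiplicativeReductionAtPrime m) →
      ¬ p ∣ W.tamagawaProduct →
      ∃ (K : Type) (_ : Field K) (_ : NumberField K) (Wd : WeierstrassCurve ℚ) (_ : Wd.IsElliptic)
        (_ : Wd.IsGloballyMinimal) (Cd : VariableChange ℚ) (qd : ℚ),
        IsImaginaryQuadratic K ∧ SatisfiesHeegnerHypothesis (W.conductorNorm ℤ) K ∧
        NumberField.discr K < -4 ∧ Cd • W.quadraticTwist (NumberField.discr K : ℚ) = Wd ∧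
        Wd.entireLFunction 1 / (Wd.realPeriodRat : ℂ) = (qd : ℂ) ∧ qd ≠ 0 ∧ padicValRat p qd = 0)
    -- (T2∗′) the exceptional conjecture, only on split-only pairs with `p ∣ ∏c` (none is semistable)
    (hC : ∀ (W : WeierstrassCurve ℚ) [W.IsElliptic] [W.IsGloballyMinimal] (p : ℕ) [Fact p.Prime],
      ClassX11b W p → 5 ≤ p → W.HasSplitMultiplicativeReductionAtPrime p →
      (¬ ∃ (m : ℕ) (_ : Fact m.Prime), m ≠ p ∧ W.HasMultiplicativeReductionAtPrime m) →
      p ∣ W.tamagawaProduct → ClassClosure.RelativeExceptionalLeadingTermAt W p)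
    -- (T4′) the corner (none is semistable)
    (hCorner : ∀ (W : WeierstrassCurve ℚ) [W.IsElliptic] [W.IsGloballyMinimal] (p : ℕ)
      [Fact p.Prime], ClassX11b W p → ¬ Surj W p → (p = 5 ∨ p = 7) →
        p ∣ padicValInt p W.minimalDiscriminantInt → ¬ Ram W p → Typed.MissingPPartAt W p)
    (W : WeierstrassCurve ℚ) [W.IsElliptic] [W.IsGloballyMinimal] (p : ℕ) [Fact p.Prime]
    (hX : ClassX11b W p) (hp5 : 5 ≤ p) : BSDp W p :=
  P2.bsdp_of_onTree_cyclotomic_twistCertificate hGZ hKo hB hWu hGZK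
    (hasEntireLFunction_rat_of_exists_isNewformOf hnf) hnf hHL hMaz hBDMTV hPT hEP hK hJn hJs hHn hHs
    hD hpar
    (fun W _ _ p _ ↦ p2OpenInputOnTreeAt_of_imp fun hX hp5 ↦ by
      by_cases hss : Semistable W
      · exact P2.openInputOnTreeAt_of_imcDiv_of_facts h32 hnf hGZK hKo hPT hEP hss (hDiv W p hX hp5 hss)
      · exact hA W p hX hp5 hss)
    hReg hTC hC hCorner W p hX hp5

end Summit.BirchSwinnertonDyer.Rank1Residual.X11b

end
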